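import Literature.Dynamics.NBody.AlbouyKaloshin2012
import Literature.Dynamics.NBody.JensenLeykin2025E32Transfer
import Literature.Dynamics.NBody.JensenLeykin2025S3Dictionary

/-!
# Planar five-body central configurations on the Albouy–Kaloshin exceptional family `E₃₂` — typed targets
(venture `CentralConfigurations`, cell `pub-smale6`)

HONEST FRAMING (cell brief, verbatim in every file): closing part of a known exceptional set by certified
computer algebra; not a new method. Smale's 6th problem for `n = 5` remains open exactly as in print.

This module TYPES the cell's target statements over the landed Literature substrate
(`Literature/Dynamics/NBody/AlbouyKaloshin2012.lean`, `…/JensenLeykin2025E32Transfer.lean`,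
`…/JensenLeykin2025S3Dictionary.lean`) and proves only elementary glue between them. Every `def … : Prop`
below is a TARGET; its docstring says which is decided, by what, at which evidence grade, and which is OPEN.
Nothing decided outside the kernel is asserted as a `theorem` here.

* `FiniteCC5_EqualPairs` — uniform finiteness on the whole family `(a,a,b,b,c)`, `a,b,c > 0`: OPEN.
* `FiniteCC5_EqualPairs_offLocus P` — finiteness off the real zero set of one explicit nonzero `P ∈ ℚ[a,b,c]`:
  `∃ P, FiniteCC5_EqualPairs_offLocus P` follows IN THE KERNEL from the tree target
  `Literature.Dynamics.NBody.E32S3Target` (`exists_offLocus_of_s3Target` below); `E32S3Target` itself is decided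
  OUTSIDE the kernel by the cell's DERIVED certificate `certs/tropical_e32/vcell_S3_001/GENERIC.md` (two
  implementations of every number, refereed R133–R137; `P` inexplicit). No explicit `P` is known.
* `FiniteCC5_at m` — finiteness at one rational mass vector (Albouy–Kaloshin's Example p. 583 is the instance
  `(1,2,3,4,5)`, `finiteCC5_at_12345_iff`).

Provenance: port of the cell's staged `HOME/lean/Smale6N5Targets.lean` + the non-superseded part of
`HOME/lean/Smale6N5TropicalE32.lean` (pub-smale6 seats 1–2, 2026-08-18/19; referee re-check rc 0, REFEREE.md gen 96),
namespace `Smale6N5` ↦ `Summit.Ventures.CentralConfigurations`, `equalPairsMasses`/`e32Masses` ↦ the tree's `massesE32`.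
-/

namespace Summit.Ventures.CentralConfigurations

open Literature.Dynamics.NBody

/-- TARGET (uniform, OPEN): finiteness of positive normalized planar central configurations (Albouy–Kaloshin
2012, Definition 1) for EVERY positive point of the exceptional component `E₃₂ = {m₁ = m₂, m₃ = m₄}`
(relation (32), case 8.6, p. 576; masses `(a,a,b,b,c)`, other renumberings by permuting the bodies).
Warning (cell REFEREE.md R5): the component carries a degenerate central configuration at `(1,1,µ,µ,ν)`,
`ν ≈ 0.518` (Moczurad–Zgliczyński 2026 p. 27, citing Chen–Hsiao), so a uniform certificate must handle
singular fibres; and it contains the Roberts line `(4s,4s,4s,4s,s)` on which every positivity-blind torus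
certificate fails (`Literature.Dynamics.NBody.e32TorusTarget_poly_vanishes_on_robertsLine`). -/
def FiniteCC5_EqualPairs : Prop :=
  ∀ a b c : ℝ, 0 < a → 0 < b → 0 < c → (positiveNormalizedCCs (massesE32 a b c)).Finite

/-- TARGET (generic on the component): finiteness for all positive `(a,b,c)` outside the real zero set of ONE
nonzero rational polynomial `P` in `(a,b,c)` — the shape a zero-dimensionality / tropical certificate over
`ℚ(a,b,c)` supports (cell REFEREE.md C4). With `P` EXPLICIT this is open; with `P` merely existing it is
`exists_offLocus_of_s3Target` applied to the DERIVED certificate of `E32S3Target`. -/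
def FiniteCC5_EqualPairs_offLocus (P : MvPolynomial (Fin 3) ℚ) : Prop :=
  P ≠ 0 ∧ ∀ a b c : ℝ, 0 < a → 0 < b → 0 < c →
    MvPolynomial.aeval ![a, b, c] P ≠ 0 → (positiveNormalizedCCs (massesE32 a b c)).Finite

/-- TARGET (per point): finiteness at one rational mass vector (the certificate shape of Albouy–Kaloshin's
Example p. 583 / Remark 7 for points off the codimension-1 relations, and of a direct zero-dimensional
computation for points on them). -/
def FiniteCC5_at (m : Fin 5 → ℚ) : Prop :=
  (positiveNormalizedCCs (fun i => (m i : ℝ))).Finite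

/-- Sanity: the per-point target at `(1,2,3,4,5)` is literally Albouy–Kaloshin's Example (a named Literature
fact, not proved in the tree). -/
theorem finiteCC5_at_12345_iff :
    FiniteCC5_at ![1, 2, 3, 4, 5] ↔ albouyKaloshin2012_example12345 := by
  have h : (fun i => ((![1, 2, 3, 4, 5] : Fin 5 → ℚ) i : ℝ)) = exampleMasses12345 := by
    funext i; fin_cases i <;> simp [exampleMasses12345]
  unfold FiniteCC5_at albouyKaloshin2012_example12345
  rw [h]

/-- The uniform target trivially implies the off-locus target for every nonzero `P`. -/
theorem offLocus_of_uniform (h : FiniteCC5_EqualPairs) (P : MvPolynomial (Fin 3) ℚ) (hP : P ≠ 0) :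
    FiniteCC5_EqualPairs_offLocus P :=
  ⟨hP, fun a b c ha hb hc _ => h a b c ha hb hc⟩

/-- GLUE between the two tree targets on `E₃₂`: the Jensen–Leykin torus target (equation set S1 =
`{g_ij, CM4}`) implies the enriched S3 target (S3 ⊇ S1 has the smaller solution set `s3NormalizedCCs ⊆
jlNormalizedCCs`). The converse is not claimed. -/
theorem e32S3Target_of_torusTarget (h : E32TorusTarget) : E32S3Target := by
  obtain ⟨P, hP, hfin⟩ := h
  exact ⟨P, hP, fun K _ _ a b c hne => (hfin K a b c hne).subset (s3NormalizedCCs_subset K _)⟩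

/-- Sanity (records the logical gap the torus target closes relative to `jlGenericFiniteness 5`, whose
hypersurface may contain the family): the torus target follows from finiteness at ALL `(a,b,c)` with
`abc ≠ 0`, with `P = abc`. -/
theorem e32TorusTarget_of_all
    (h : ∀ (K : Type) [Field K] [CharZero K] (a b c : K), a * b * c ≠ 0 →
      (jlNormalizedCCs K (massesE32 a b c)).Finite) :
    E32TorusTarget := by
  refine ⟨MvPolynomial.X 0 * MvPolynomial.X 1 * MvPolynomial.X 2, ?_, ?_⟩
  · intro h0
    have := congrArg (MvPolynomial.aeval (![1, 1, 1] : Fin 3 → ℚ)) h0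
    simp at this
  · intro K _ _ a b c hP
    apply h K a b c
    simpa using hP

/-- KERNEL TRANSFER: the torus target on `E₃₂` yields the off-locus target for SOME nonzero `P`
(through `e32_generic_positiveCC_finite_of_torusTarget_pos`). No S1 certificate exists (Jensen–Leykin 2025
§4.2 report failure at valuations `(a,a,b,b,c)`; the cell's S1 runs are negative), so this is recorded, not used. -/
theorem exists_offLocus_of_torusTarget (h : E32TorusTarget) :
    ∃ P : MvPolynomial (Fin 3) ℚ, FiniteCC5_EqualPairs_offLocus P := by
  obtain ⟨P, hP0, hP⟩ := e32_generic_positiveCC_finite_of_torusTarget_pos h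
  exact ⟨P, hP0, hP⟩

/-- KERNEL TRANSFER (the one the packet uses): the S3 target on `E₃₂` — decided OUTSIDE the kernel by the
DERIVED certificate GENERIC.md (CERT §9), `P` inexplicit — yields the off-locus finiteness target for SOME
nonzero `P ∈ ℚ[a,b,c]`: generic-on-`E₃₂` finiteness of positive normalized planar central configurations. -/
theorem exists_offLocus_of_s3Target (h : E32S3Target) :
    ∃ P : MvPolynomial (Fin 3) ℚ, FiniteCC5_EqualPairs_offLocus P := by
  obtain ⟨P, hP0, hP⟩ := e32_generic_positiveCC_finite_of_s3Target h
  refine ⟨P, hP0, fun a b c ha hb hc hne => ?_⟩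
  have hM : 0 < 2 * a + 2 * b + c := by linarith
  simpa [massesE32] using hP a b c hM hne

end Summit.Ventures.CentralConfigurations
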